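import Literature.AlgebraicGeometry.Frobenioids.EquivalenceFrobeniusType
import Literature.AlgebraicGeometry.Frobenioids.IrreducibleMorphisms
import Literature.AlgebraicGeometry.Frobenioids.Composites
import HarnessLib

/-!
# Frobenioids I, Theorem 3.4 (iii): the case of Frobenioids of group-like type

Mochizuki, *The geometry of Frobenioids I: the general theory*, Kyushu J. Math. **62** (2008)
293–400, Thm. 3.4 (iii), kurims p. 62, hypothesis (b) ("if `C₁`, `C₂` are of group-like type, then
both `Ψ` and some quasi-inverse to `Ψ` preserve base-isomorphisms") and the group-like case of the
proof, p. 65 ll. 6–12 [cite: MochizukiFrdI2008, Thm. 3.4 (iii) p.65]: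

> "Let us first consider the case where `C₁`, `C₂` are of group-like type. Then all pre-steps of
> `C₁`, `C₂` are isomorphisms; `Ψ` preserves base-isomorphisms. Thus, for any `A₁ ∈ Ob(C₁)`, the
> prime-Frobenius morphisms with domain `A₁` are precisely the irreducible base-isomorphisms with
> domain `A₁` [cf. Proposition 1.14, (i)]. In particular, `Ψ` preserves the prime-Frobenius
> morphisms; hence, we conclude that assertion (F1) holds."

PROOF-ONLY file (seat abc-iut-L1-t11; sub-DAG row `FrdI:Thm3.4(iii)/L01g GroupLikeTypeCase` of
`plan/L1/SUBDAG-FrdI-Thm34.md`), complementing seat abc-iut-L1-t13's treatment of the case with a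
non-group-like object (`EquivalenceFrobeniusType.lean`, `EquivalenceFrobeniusQuasiIsotropic.lean`). For
Frobenioids `C₁`, `C₂` of ISOTROPIC and GROUP-LIKE type (every object group-like: `Φ_i(A) = 0`) and an
equivalence `Ψ` such that `Ψ` [resp. `Ψ⁻¹`] preserves base-isomorphisms (hypothesis (b)):

* in a Frobenioid of isotropic type, out of a group-like object: every morphism is an isometry, the
  morphisms of Frobenius type are exactly the base-isomorphisms, pre-steps are isomorphisms, and the
  prime-Frobenius morphisms are exactly the irreducible base-isomorphisms (Prop. 1.14 (i));
* hence `Ψ` preserves morphisms of Frobenius type, prime-Frobenius morphisms, base-isomorphisms,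
  isometries, co-angular and LB-invertible morphisms, and — `Ψ⁻¹` preserving base-isomorphisms —
  linear morphisms (Prop. 1.7 (iii)) and pull-back morphisms (Prop. 1.7 (ii)): the morphism list of
  Thm. 3.4 (iii) (`FrdI.thm34iii_morphisms_of_groupLikeType`);
* (F1)/(F2) in the group-like case: for every prime `p` there is a prime `p'` such that `Ψ` maps
  every `p`-Frobenius morphism to a `p'`-Frobenius morphism (`FrdI.exists_admissible_all_of_groupLikeType`:
  Def. 1.3 (ii) at one object, transport along isomorphisms of objects with isomorphic bases
  (Def. 1.3 (i)(b): the connecting pre-steps are invertible here) and along pull-back morphisms over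
  arrows of the base (Def. 1.3 (i)(a)(c), Prop. 1.11 (iii), Prop. 1.14 (iv) — seat abc-iut-L1-t13's
  `admissible_of_rep`, `exists_frobenius_endo_lift`, `isPrimeFrobenius_map_iff_of_isPullbackMorphism`),
  connectedness of `D₁`).

The monoid automorphism `Ψ^{ℕ≥1}` is assembled from this in a companion file. No base-category
hypothesis (FSM/FSMFF-type) and no non-dilation hypothesis is needed in the group-like case. No
statement of the paper is restated or strengthened.
-/

set_option backward.isDefEq.respectTransparency false

namespace Literature.AlgebraicGeometry.Frobenioids

open CategoryTheory Opposite

universe w v v' u u'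

namespace FrdI

/-! ### One Frobenioid: morphisms out of a group-like object (isotropic type) -/

section One

variable {D : Type u} [Category.{v} D] {Φ : Dᵒᵖ ⥤ CommMonCat.{w}} {C : Type u'} [Category.{v'} C]
  {F : C ⥤ ElemFrobenioid Φ}

/-- Out of a group-like object every morphism is an isometry (`Φ(A) = 0`).
[cite: MochizukiFrdI2008, Thm. 3.4 (iii) p.65] -/
theorem isIsometry_of_isGroupLikeObj {A B : C} (hA : PreFrobenioid.IsGroupLikeObj F A) (φ : A ⟶ B) :
    PreFrobenioid.IsIsometry F φ :=
  hA _

/-- Out of a group-like object of a Frobenioid of isotropic type, the morphisms of Frobenius type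
are exactly the base-isomorphisms (every morphism is a co-angular isometry, Prop. 1.4 (i)).
[cite: MochizukiFrdI2008, Thm. 3.4 (iii) p.65] -/
theorem isFrobeniusType_iff_isBaseIso_of_isGroupLikeObj (hist : PreFrobenioid.IsOfIsotropicType F)
    {A B : C} (hA : PreFrobenioid.IsGroupLikeObj F A) (φ : A ⟶ B) :
    PreFrobenioid.IsFrobeniusType F φ ↔ PreFrobenioid.IsBaseIso F φ :=
  ⟨fun h => h.2, fun h => ⟨⟨PreFrobenioid.isCoAngular_of_isOfIsotropicType F hist φ, hA _⟩, h⟩⟩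

/-- "Then all pre-steps of `C₁`, `C₂` are isomorphisms" (p. 65): a pre-step out of a group-like
object of a Frobenioid of isotropic type is an isomorphism (it is an isometric pre-step).
[cite: MochizukiFrdI2008, Thm. 3.4 (iii) p.65] -/
theorem isIso_of_isPreStep_of_isGroupLikeObj (hist : PreFrobenioid.IsOfIsotropicType F) {A B : C}
    (hA : PreFrobenioid.IsGroupLikeObj F A) {φ : A ⟶ B} (hφ : PreFrobenioid.IsPreStep F φ) : IsIso φ :=
  hist A φ (hA _) hφ

/-- "For any `A₁ ∈ Ob(C₁)`, the prime-Frobenius morphisms with domain `A₁` are precisely the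
irreducible base-isomorphisms with domain `A₁` [cf. Proposition 1.14, (i)]" — for `A₁` group-like
in a Frobenioid of isotropic type (cases (b), (c) of Prop. 1.14 (i) are excluded: a step has a
non-zero zero divisor, a pull-back morphism with irreducible projection is not a base-isomorphism).
[cite: MochizukiFrdI2008, Thm. 3.4 (iii) p.65] -/
theorem isPrimeFrobenius_iff_of_isGroupLikeObj (hF : PreFrobenioid.IsFrobenioid F)
    (hist : PreFrobenioid.IsOfIsotropicType F) {A B : C} (hA : PreFrobenioid.IsGroupLikeObj F A)
    (φ : A ⟶ B) :
    PreFrobenioid.IsPrimeFrobenius F φ ↔ IsIrreducibleHom φ ∧ PreFrobenioid.IsBaseIso F φ := by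
  constructor
  · exact fun h => ⟨h.isIrreducibleHom hF (hist A), h.1.2⟩
  · rintro ⟨hirr, hb⟩
    rcases PreFrobenioid.trichotomy_of_isIrreducibleHom F hF hist hirr with ha | ⟨-, hdiv⟩ | ⟨-, hcirr⟩
    · exact ha
    · exact (hdiv.1 (hA _)).elim
    · exact (hcirr.1 hb).elim

end One

/-! ### Two Frobenioids of isotropic and group-like type and an equivalence -/

section Two

variable {D₁ : Type u} [Category.{v} D₁] {Φ₁ : D₁ᵒᵖ ⥤ CommMonCat.{w}} {C₁ : Type u'}
  [Category.{v'} C₁] {D₂ : Type u} [Category.{v} D₂] {Φ₂ : D₂ᵒᵖ ⥤ CommMonCat.{w}} {C₂ : Type u'}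
  [Category.{v'} C₂] {F₁ : C₁ ⥤ ElemFrobenioid Φ₁} {F₂ : C₂ ⥤ ElemFrobenioid Φ₂}

/-- **Group-like type, (b) ⇒ `Ψ` preserves morphisms of Frobenius type** (= base-isomorphisms here).
[cite: MochizukiFrdI2008, Thm. 3.4 (iii) p.65] -/
theorem isFrobeniusType_map_of_groupLikeType (hi₂ : ∀ A : C₂, PreFrobenioid.IsIsotropic F₂ A)
    (hg₂ : ∀ A : C₂, PreFrobenioid.IsGroupLikeObj F₂ A) (Ψ : C₁ ≌ C₂)
    (hB : ∀ ⦃A B : C₁⦄ (φ : A ⟶ B), PreFrobenioid.IsBaseIso F₁ φ →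
      PreFrobenioid.IsBaseIso F₂ (Ψ.functor.map φ))
    {A B : C₁} {φ : A ⟶ B} (hφ : PreFrobenioid.IsFrobeniusType F₁ φ) :
    PreFrobenioid.IsFrobeniusType F₂ (Ψ.functor.map φ) :=
  (isFrobeniusType_iff_isBaseIso_of_isGroupLikeObj hi₂ (hg₂ _) _).2 (hB φ hφ.2)

/-- **Group-like type, (b) ⇒ `Ψ` preserves prime-Frobenius morphisms** ("In particular, `Ψ`
preserves the prime-Frobenius morphisms", p. 65: irreducibility is categorical, base-isomorphisms
are preserved by (b)). [cite: MochizukiFrdI2008, Thm. 3.4 (iii) p.65] -/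
theorem isPrimeFrobenius_map_of_groupLikeType (hF₁ : PreFrobenioid.IsFrobenioid F₁)
    (hF₂ : PreFrobenioid.IsFrobenioid F₂) (hi₁ : ∀ A : C₁, PreFrobenioid.IsIsotropic F₁ A)
    (hi₂ : ∀ A : C₂, PreFrobenioid.IsIsotropic F₂ A) (hg₁ : ∀ A : C₁, PreFrobenioid.IsGroupLikeObj F₁ A)
    (hg₂ : ∀ A : C₂, PreFrobenioid.IsGroupLikeObj F₂ A) (Ψ : C₁ ≌ C₂)
    (hB : ∀ ⦃A B : C₁⦄ (φ : A ⟶ B), PreFrobenioid.IsBaseIso F₁ φ →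
      PreFrobenioid.IsBaseIso F₂ (Ψ.functor.map φ))
    {A B : C₁} {φ : A ⟶ B} (hφ : PreFrobenioid.IsPrimeFrobenius F₁ φ) :
    PreFrobenioid.IsPrimeFrobenius F₂ (Ψ.functor.map φ) := by
  obtain ⟨hirr, hb⟩ := (isPrimeFrobenius_iff_of_isGroupLikeObj hF₁ hi₁ (hg₁ A) φ).1 hφ
  exact (isPrimeFrobenius_iff_of_isGroupLikeObj hF₂ hi₂ (hg₂ _) _).2
    ⟨hirr.map_equivalence Ψ, hB φ hb⟩

/-- **Group-like type, (b) for `Ψ⁻¹` ⇒ `Ψ` preserves linear morphisms** (Prop. 1.7 (iii): linear =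
minimal-adjoint to the morphisms of Frobenius type, which `Ψ⁻¹` preserves).
[cite: MochizukiFrdI2008, Thm. 3.4 (iii) p.64] -/
theorem isLinear_map_of_groupLikeType (hF₁ : PreFrobenioid.IsFrobenioid F₁)
    (hF₂ : PreFrobenioid.IsFrobenioid F₂) (hi₁ : ∀ A : C₁, PreFrobenioid.IsIsotropic F₁ A)
    (hg₁ : ∀ A : C₁, PreFrobenioid.IsGroupLikeObj F₁ A) (Ψ : C₁ ≌ C₂)
    (hB' : ∀ ⦃X Y : C₂⦄ (β : X ⟶ Y), PreFrobenioid.IsBaseIso F₂ β →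
      PreFrobenioid.IsBaseIso F₁ (Ψ.inverse.map β))
    {A B : C₁} {φ : A ⟶ B} (hφ : PreFrobenioid.IsLinear F₁ φ) :
    PreFrobenioid.IsLinear F₂ (Ψ.functor.map φ) := by
  rw [PreFrobenioid.isLinear_iff_isMinimalAdjoint F₂ hF₂]
  refine ((PreFrobenioid.isLinear_iff_isMinimalAdjoint F₁ hF₁ φ).1 hφ).map_equivalence Ψ
    (S₂ := fun _ _ f => PreFrobenioid.IsFrobeniusType F₂ f) (fun X Y β hβ => ?_)
    (fun X X' Y i β hi hβ => ?_)
  · exact (isFrobeniusType_iff_isBaseIso_of_isGroupLikeObj hi₁ (hg₁ _) _).2 (hB' β hβ.2)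
  · haveI := hi
    exact PreFrobenioid.IsFrobeniusType.comp F₁ hF₁
      (PreFrobenioid.isFrobeniusType_of_isIso F₁ hF₁.isPreFrobenioid i) hβ

/-- **Group-like type, (b) for `Ψ⁻¹` ⇒ `Ψ` preserves pull-back morphisms** (Prop. 1.7 (ii):
pull-back = minimal-adjoint to the base-isomorphisms, which `Ψ⁻¹` preserves).
[cite: MochizukiFrdI2008, Thm. 3.4 (iii) p.64] -/
theorem isPullbackMorphism_map_of_groupLikeType (hF₁ : PreFrobenioid.IsFrobenioid F₁)
    (hF₂ : PreFrobenioid.IsFrobenioid F₂) (Ψ : C₁ ≌ C₂)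
    (hB' : ∀ ⦃X Y : C₂⦄ (β : X ⟶ Y), PreFrobenioid.IsBaseIso F₂ β →
      PreFrobenioid.IsBaseIso F₁ (Ψ.inverse.map β))
    {A B : C₁} {φ : A ⟶ B} (hφ : PreFrobenioid.IsPullbackMorphism F₁ φ) :
    PreFrobenioid.IsPullbackMorphism F₂ (Ψ.functor.map φ) := by
  rw [PreFrobenioid.isPullbackMorphism_iff_isMinimalAdjoint F₂ hF₂]
  refine ((PreFrobenioid.isPullbackMorphism_iff_isMinimalAdjoint F₁ hF₁ φ).1 hφ).map_equivalence Ψ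
    (S₂ := PreFrobenioid.baseIsomorphisms F₂) (fun X Y β hβ => ?_) (fun X X' Y i β hi hβ => ?_)
  · exact hB' β hβ
  · haveI := hi
    exact PreFrobenioid.IsBaseIso.comp F₁ (PreFrobenioid.isBaseIso_of_isIso F₁ i) hβ

/-- **Group-like type ⇒ `Ψ` preserves isometries** (every morphism of `C₂` is an isometry).
[cite: MochizukiFrdI2008, Thm. 3.4 (iii) p.65] -/
theorem isIsometry_map_of_groupLikeType (hg₂ : ∀ A : C₂, PreFrobenioid.IsGroupLikeObj F₂ A)
    (Ψ : C₁ ≌ C₂) {A B : C₁} (φ : A ⟶ B) : PreFrobenioid.IsIsometry F₂ (Ψ.functor.map φ) :=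
  hg₂ _ _

/-- Isotropic type ⇒ `Ψ` preserves co-angular morphisms (every morphism of `C₂` is co-angular,
Prop. 1.4 (i)). [cite: MochizukiFrdI2008, Thm. 3.4 (iii) p.64] -/
theorem isCoAngular_map_of_isotropicType (hi₂ : ∀ A : C₂, PreFrobenioid.IsIsotropic F₂ A)
    (Ψ : C₁ ≌ C₂) {A B : C₁} (φ : A ⟶ B) : PreFrobenioid.IsCoAngular F₂ (Ψ.functor.map φ) :=
  PreFrobenioid.isCoAngular_of_isIsotropic_codomains F₂ _ fun Z _ => hi₂ Z

/-- **Group-like and isotropic type ⇒ `Ψ` preserves LB-invertible morphisms.**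
[cite: MochizukiFrdI2008, Thm. 3.4 (iii) p.64] -/
theorem isLBInvertible_map_of_groupLikeType (hi₂ : ∀ A : C₂, PreFrobenioid.IsIsotropic F₂ A)
    (hg₂ : ∀ A : C₂, PreFrobenioid.IsGroupLikeObj F₂ A) (Ψ : C₁ ≌ C₂) {A B : C₁} (φ : A ⟶ B) :
    PreFrobenioid.IsLBInvertible F₂ (Ψ.functor.map φ) :=
  ⟨isCoAngular_map_of_isotropicType hi₂ Ψ φ, isIsometry_map_of_groupLikeType hg₂ Ψ φ⟩

/-! ### (F1)/(F2) in the group-like case: the prime `p'` attached to `p` -/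

/-- Transport of "`Ψ` maps every `p`-Frobenius morphism out of `X` to a `p'`-Frobenius morphism"
along an isomorphism `X ≅ Y`. [cite: MochizukiFrdI2008, Thm. 3.4 (iii) p.64] -/
theorem admissible_of_iso (hF₁ : PreFrobenioid.IsFrobenioid F₁) (hF₂ : PreFrobenioid.IsFrobenioid F₂)
    (Ψ : C₁ ≌ C₂) {p p' : ℕ+} {X Y : C₁} (e : X ≅ Y)
    (hX : ∀ ⦃X' : C₁⦄ (f : X ⟶ X'), PreFrobenioid.IsFrobeniusType F₁ f → PreFrobenioid.degFr F₁ f = p →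
      PreFrobenioid.IsPrimeFrobenius F₂ (Ψ.functor.map f) ∧ PreFrobenioid.degFr F₂ (Ψ.functor.map f) = p') :
    ∀ ⦃Y' : C₁⦄ (f : Y ⟶ Y'), PreFrobenioid.IsFrobeniusType F₁ f → PreFrobenioid.degFr F₁ f = p →
      PreFrobenioid.IsPrimeFrobenius F₂ (Ψ.functor.map f) ∧ PreFrobenioid.degFr F₂ (Ψ.functor.map f) = p' := by
  intro Y' f hf hfd
  have hP₁ := hF₁.isPreFrobenioid
  have hef : PreFrobenioid.IsFrobeniusType F₁ (e.hom ≫ f) :=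
    PreFrobenioid.IsFrobeniusType.comp F₁ hF₁ (PreFrobenioid.isFrobeniusType_of_isIso F₁ hP₁ e.hom) hf
  have hefd : PreFrobenioid.degFr F₁ (e.hom ≫ f) = p := by
    rw [PreFrobenioid.degFr_comp, show PreFrobenioid.degFr F₁ e.hom = 1 from
      PreFrobenioid.isLinear_of_isIso F₁ e.hom, one_mul, hfd]
  obtain ⟨h1, h2⟩ := hX (e.hom ≫ f) hef hefd
  have hf' : f = e.inv ≫ e.hom ≫ f := by rw [Iso.inv_hom_id_assoc]
  rw [hf', Functor.map_comp]
  refine ⟨by simpa using isPrimeFrobenius_iso_comp_iso hF₂ (Ψ.functor.map e.inv) h1 (𝟙 _), ?_⟩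
  rw [PreFrobenioid.degFr_comp, show PreFrobenioid.degFr F₂ (Ψ.functor.map e.inv) = 1 from
    PreFrobenioid.isLinear_of_isIso F₂ _, one_mul, h2]

/-- (F2), pre-step case, group-like type: transport between objects with isomorphic bases — the
connecting span of pre-steps of Def. 1.3 (i)(b) consists of isomorphisms.
[cite: MochizukiFrdI2008, Thm. 3.4 (iii) p.65] -/
theorem admissible_of_baseIso_of_groupLikeType (hF₁ : PreFrobenioid.IsFrobenioid F₁)
    (hF₂ : PreFrobenioid.IsFrobenioid F₂) (hi₁ : ∀ A : C₁, PreFrobenioid.IsIsotropic F₁ A)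
    (hg₁ : ∀ A : C₁, PreFrobenioid.IsGroupLikeObj F₁ A) (Ψ : C₁ ≌ C₂) {p p' : ℕ+} {A B : C₁}
    (e : PreFrobenioid.baseObj F₁ A ≅ PreFrobenioid.baseObj F₁ B)
    (hA : ∀ ⦃A' : C₁⦄ (f : A ⟶ A'), PreFrobenioid.IsFrobeniusType F₁ f → PreFrobenioid.degFr F₁ f = p →
      PreFrobenioid.IsPrimeFrobenius F₂ (Ψ.functor.map f) ∧ PreFrobenioid.degFr F₂ (Ψ.functor.map f) = p') :
    ∀ ⦃B' : C₁⦄ (f : B ⟶ B'), PreFrobenioid.IsFrobeniusType F₁ f → PreFrobenioid.degFr F₁ f = p →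
      PreFrobenioid.IsPrimeFrobenius F₂ (Ψ.functor.map f) ∧ PreFrobenioid.degFr F₂ (Ψ.functor.map f) = p' := by
  obtain ⟨X, φ, ψ, hφ, hψ, -⟩ := hF₁.i_b A B e
  haveI : IsIso φ := isIso_of_isPreStep_of_isGroupLikeObj hi₁ (hg₁ X) hφ
  haveI : IsIso ψ := isIso_of_isPreStep_of_isGroupLikeObj hi₁ (hg₁ X) hψ
  exact admissible_of_iso hF₁ hF₂ Ψ (asIso ψ) (admissible_of_iso hF₁ hF₂ Ψ (asIso φ).symm hA)

/-- (F2), pull-back case, group-like type: transport in both directions along an arrow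
`u : P → Q` of the base — through a Frobenius-trivial object over `Q` (Def. 1.3 (i)(a)), a pull-back
morphism over `u` into it (Def. 1.3 (i)(c)), the lifted Frobenius endomorphism (Prop. 1.11 (iii))
and Prop. 1.14 (iv) (the argument and the three inputs are seat abc-iut-L1-t13's; only the transport
between objects with isomorphic bases differs). [cite: MochizukiFrdI2008, Thm. 3.4 (iii) p.65] -/
theorem admissible_iff_of_base_hom_of_groupLikeType (hF₁ : PreFrobenioid.IsFrobenioid F₁)
    (hF₂ : PreFrobenioid.IsFrobenioid F₂) (hi₁ : ∀ A : C₁, PreFrobenioid.IsIsotropic F₁ A)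
    (hi₂ : ∀ A : C₂, PreFrobenioid.IsIsotropic F₂ A) (hg₁ : ∀ A : C₁, PreFrobenioid.IsGroupLikeObj F₁ A)
    (Ψ : C₁ ≌ C₂) {p p' : ℕ+} (hp : (p : ℕ).Prime) {P Q : D₁} (u : P ⟶ Q) {A B : C₁}
    (eA : PreFrobenioid.baseObj F₁ A ≅ P) (eB : PreFrobenioid.baseObj F₁ B ≅ Q) :
    (∀ ⦃A' : C₁⦄ (f : A ⟶ A'), PreFrobenioid.IsFrobeniusType F₁ f → PreFrobenioid.degFr F₁ f = p →
      PreFrobenioid.IsPrimeFrobenius F₂ (Ψ.functor.map f) ∧ PreFrobenioid.degFr F₂ (Ψ.functor.map f) = p') ↔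
    (∀ ⦃B' : C₁⦄ (f : B ⟶ B'), PreFrobenioid.IsFrobeniusType F₁ f → PreFrobenioid.degFr F₁ f = p →
      PreFrobenioid.IsPrimeFrobenius F₂ (Ψ.functor.map f) ∧ PreFrobenioid.degFr F₂ (Ψ.functor.map f) = p') := by
  obtain ⟨T, hT, ⟨eT⟩⟩ := hF₁.i_a Q
  obtain ⟨W, ζ, i, hζ, -⟩ := exists_isPullbackMorphism_over' hF₁ T (u ≫ eT.inv)
  obtain ⟨z, hz⟩ := hT
  obtain ⟨hzd, hzb, hzF⟩ := hz p
  obtain ⟨φ, hφF, -, hφd, hsq⟩ := exists_frobenius_endo_lift hF₁ hi₁ hζ hzF hzb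
  have hzp : PreFrobenioid.IsPrimeFrobenius F₁ (z p) := ⟨hzF, by rw [hzd]; exact hp⟩
  have hφp : PreFrobenioid.IsPrimeFrobenius F₁ φ := ⟨hφF, by rw [hφd, hzd]; exact hp⟩
  obtain ⟨hiff, hdeg⟩ := isPrimeFrobenius_map_iff_of_isPullbackMorphism hF₁ hF₂ hi₁ hi₂ Ψ hφp hzp hsq
  constructor
  · intro hA
    obtain ⟨h1, h2⟩ := admissible_of_baseIso_of_groupLikeType hF₁ hF₂ hi₁ hg₁ Ψ (eA.trans i.symm) hA φ
      hφF (hφd.trans hzd)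
    exact admissible_of_baseIso_of_groupLikeType hF₁ hF₂ hi₁ hg₁ Ψ (eT.trans eB.symm)
      (admissible_of_rep hF₁ hF₂ Ψ hzF hzd (hiff.1 h1) (hdeg ▸ h2))
  · intro hB
    obtain ⟨h1, h2⟩ := admissible_of_baseIso_of_groupLikeType hF₁ hF₂ hi₁ hg₁ Ψ (eB.trans eT.symm) hB
      (z p) hzF hzd
    exact admissible_of_baseIso_of_groupLikeType hF₁ hF₂ hi₁ hg₁ Ψ (i.trans eA.symm)
      (admissible_of_rep hF₁ hF₂ Ψ hφF (hφd.trans hzd) (hiff.2 h1) (hdeg.symm ▸ h2))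

/-- **Thm. 3.4 (iii), (F1)+(F2) for Frobenioids of group-like type: `Ψ` maps `p`-Frobenius
morphisms to `p'`-Frobenius morphisms for a single prime `p'` depending only on the prime `p`** —
isotropic type, `Ψ` preserving base-isomorphisms; the value `p'` is read off at any one object
(Def. 1.3 (ii)) and is constant along the connected base.
[cite: MochizukiFrdI2008, Thm. 3.4 (iii) p.65] -/
theorem exists_admissible_all_of_groupLikeType (hF₁ : PreFrobenioid.IsFrobenioid F₁)
    (hF₂ : PreFrobenioid.IsFrobenioid F₂) (hi₁ : ∀ A : C₁, PreFrobenioid.IsIsotropic F₁ A)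
    (hi₂ : ∀ A : C₂, PreFrobenioid.IsIsotropic F₂ A) (hg₁ : ∀ A : C₁, PreFrobenioid.IsGroupLikeObj F₁ A)
    (hg₂ : ∀ A : C₂, PreFrobenioid.IsGroupLikeObj F₂ A) (Ψ : C₁ ≌ C₂)
    (hB : ∀ ⦃A B : C₁⦄ (φ : A ⟶ B), PreFrobenioid.IsBaseIso F₁ φ →
      PreFrobenioid.IsBaseIso F₂ (Ψ.functor.map φ))
    (p : ℕ+) (hp : (p : ℕ).Prime) :
    ∃ p' : ℕ+, (p' : ℕ).Prime ∧ ∀ A : C₁, ∀ ⦃A' : C₁⦄ (f : A ⟶ A'), PreFrobenioid.IsFrobeniusType F₁ f →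
      PreFrobenioid.degFr F₁ f = p →
        PreFrobenioid.IsPrimeFrobenius F₂ (Ψ.functor.map f) ∧ PreFrobenioid.degFr F₂ (Ψ.functor.map f) = p' := by
  have hP₁ := hF₁.isPreFrobenioid
  obtain ⟨N⟩ := hP₁.isGraphConnected.nonempty
  -- the value `p'`: the degree of the image of the `p`-Frobenius morphism out of `N`
  obtain ⟨N', f₀, hf₀, hf₀d⟩ := hF₁.ii_exists N p
  have hf₀p : PreFrobenioid.IsPrimeFrobenius F₁ f₀ := ⟨hf₀, by rw [hf₀d]; exact hp⟩
  have hΨf₀ := isPrimeFrobenius_map_of_groupLikeType hF₁ hF₂ hi₁ hi₂ hg₁ hg₂ Ψ hB hf₀p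
  refine ⟨PreFrobenioid.degFr F₂ (Ψ.functor.map f₀), hΨf₀.2, ?_⟩
  -- admissibility of all objects over a given base object is constant along the (connected) base
  let S : D₁ → Prop := fun P => ∀ ⦃B : C₁⦄, Nonempty (PreFrobenioid.baseObj F₁ B ≅ P) →
    ∀ ⦃B' : C₁⦄ (f : B ⟶ B'), PreFrobenioid.IsFrobeniusType F₁ f → PreFrobenioid.degFr F₁ f = p →
      PreFrobenioid.IsPrimeFrobenius F₂ (Ψ.functor.map f) ∧
        PreFrobenioid.degFr F₂ (Ψ.functor.map f) = PreFrobenioid.degFr F₂ (Ψ.functor.map f₀)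
  have hstep : ∀ {P Q : D₁}, Nonempty (P ⟶ Q) ∨ Nonempty (Q ⟶ P) → (S P ↔ S Q) := by
    have one : ∀ {P Q : D₁} (_ : P ⟶ Q), S P → S Q := by
      intro P Q u hP B ⟨eB⟩
      obtain ⟨TA, -, ⟨eA⟩⟩ := hF₁.i_a P
      exact (admissible_iff_of_base_hom_of_groupLikeType hF₁ hF₂ hi₁ hi₂ hg₁ Ψ hp u eA eB).1 (hP ⟨eA⟩)
    have two : ∀ {P Q : D₁} (_ : P ⟶ Q), S Q → S P := by
      intro P Q u hQ A ⟨eA⟩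
      obtain ⟨TB, -, ⟨eB⟩⟩ := hF₁.i_a Q
      exact (admissible_iff_of_base_hom_of_groupLikeType hF₁ hF₂ hi₁ hi₂ hg₁ Ψ hp u eA eB).2 (hQ ⟨eB⟩)
    intro P Q h
    rcases h with ⟨⟨u⟩⟩ | ⟨⟨u⟩⟩
    · exact ⟨one u, two u⟩
    · exact ⟨two u, one u⟩
  have hconst : ∀ P Q : D₁, S P ↔ S Q := by
    intro P Q
    induction hP₁.isGraphConnected_base.zigzag P Q with
    | refl => exact Iff.rfl
    | tail _ hbc ih => exact ih.trans (hstep hbc)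
  have hSN : S (PreFrobenioid.baseObj F₁ N) := fun B ⟨eB⟩ =>
    admissible_of_baseIso_of_groupLikeType hF₁ hF₂ hi₁ hg₁ Ψ eB.symm
      (admissible_of_rep hF₁ hF₂ Ψ hf₀ hf₀d hΨf₀ rfl)
  exact fun A => (hconst _ _).1 hSN ⟨Iso.refl _⟩

/-- **The Frobenius degree of the image of a prime-Frobenius morphism depends only on its degree**
(group-like type; the assignment `p ↦ p'` of the printed proof, p. 64).
[cite: MochizukiFrdI2008, Thm. 3.4 (iii) p.64] -/
theorem degFr_map_eq_of_degFr_eq_of_groupLikeType (hF₁ : PreFrobenioid.IsFrobenioid F₁)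
    (hF₂ : PreFrobenioid.IsFrobenioid F₂) (hi₁ : ∀ A : C₁, PreFrobenioid.IsIsotropic F₁ A)
    (hi₂ : ∀ A : C₂, PreFrobenioid.IsIsotropic F₂ A) (hg₁ : ∀ A : C₁, PreFrobenioid.IsGroupLikeObj F₁ A)
    (hg₂ : ∀ A : C₂, PreFrobenioid.IsGroupLikeObj F₂ A) (Ψ : C₁ ≌ C₂)
    (hB : ∀ ⦃A B : C₁⦄ (φ : A ⟶ B), PreFrobenioid.IsBaseIso F₁ φ →
      PreFrobenioid.IsBaseIso F₂ (Ψ.functor.map φ))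
    {A A' B B' : C₁} {f : A ⟶ A'} {g : B ⟶ B'} (hf : PreFrobenioid.IsPrimeFrobenius F₁ f)
    (hg : PreFrobenioid.IsPrimeFrobenius F₁ g) (hd : PreFrobenioid.degFr F₁ f = PreFrobenioid.degFr F₁ g) :
    PreFrobenioid.degFr F₂ (Ψ.functor.map f) = PreFrobenioid.degFr F₂ (Ψ.functor.map g) := by
  obtain ⟨p', -, hall⟩ := exists_admissible_all_of_groupLikeType hF₁ hF₂ hi₁ hi₂ hg₁ hg₂ Ψ hB
    (PreFrobenioid.degFr F₁ f) hf.2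
  rw [(hall A f hf.1 rfl).2, (hall B g hg.1 hd.symm).2]

end Two

end FrdI

end Literature.AlgebraicGeometry.Frobenioids
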